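import Literature.Probability.LatticeModels.AnisotropicLatticeGreenLimit
import Literature.Probability.LatticeModels.AnisotropicInfraredConstantBound
import HarnessLib

/-!
# Bridge: ONE threshold object for the anisotropic infrared floor (`anisoLatticeGreen` ≡ FILS's `C₀`,
# `klsConstant`)

Topic `Probability/LatticeModels`, namespace `Literature.Probability.LatticeModels.AnisotropicRotator`.
Two kernel lineages of Fröhlich–Israel–Lieb–Simon's anisotropic infrared-bound floor for the layered
plane rotator landed in parallel on 2026-08-27: `AnisotropicNVectorInfraredBound` →
`AnisotropicPlaneRotatorInfraredBound` → `AnisotropicPlaneRotatorLROInfrared` →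
`AnisotropicInfraredConstantBound` (objects `NVectorAniso.anisoDispersion`, `infraredConstant`,
`klsDispersion`, `klsConstant`, with the explicit bound `klsConstant_le`) and
`NVectorAnisotropicGaussianDomination` → `NVectorAnisotropicInfraredBound` →
`AnisotropicPlaneRotatorInfraredFloor` → `AnisotropicLatticeGreenLimit` (objects
`NVector.anisoDispersion`, `anisoTorusGreen`, `anisoLatticeGreen`). This file identifies the threshold
objects so that the tree carries ONE constant: `anisoLatticeGreen K = infraredConstant K`
(FILS (4.7), `C₀`), `anisoLatticeGreen (J∥,J∥,J⊥) = klsConstant (J⊥/J∥) / J∥`, and in particular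
`anisoLatticeGreen (1,1,r) = klsConstant r`; consequently the explicit logarithmic bound of
`klsConstant_le` and every certified enclosure of `klsConstant` apply verbatim to the floor
`layered_longRangeOrder_aniso`, and conversely. No new mathematics.

## References

* J. Fröhlich, R. Israel, E. H. Lieb, B. Simon, Comm. Math. Phys. 62 (1978) 1–34, §4, (4.7) [FILS1978].
* T. Kennedy, E. H. Lieb, B. S. Shastry, J. Stat. Phys. 53 (1988) 1019–1030, eq. (7) [KLS1988JSP].
-/

noncomputable section

open MeasureTheory Set Finset Filter
open scoped BigOperators Real

namespace Literature.Probability.LatticeModels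

namespace AnisotropicRotator

variable {d : ℕ}

/-- The two anisotropic dispersions of the tree are the same function
`ε_K(p) = ∑ᵢ Kᵢ(1 − cos pᵢ)`. [cite: FILS1978, §4, (4.7)] -/
theorem nVector_anisoDispersion_eq (K : Fin d → ℝ) (p : Fin d → ℝ) :
    NVector.anisoDispersion K p = NVectorAniso.anisoDispersion K p := rfl

/-- **`anisoLatticeGreen K = infraredConstant K`**: both are FILS's
`C₀ = (2π)⁻³∫_{[-π,π]³} dp/ε_K(p)`. [cite: FILS1978, §4, (4.7)] -/
theorem anisoLatticeGreen_eq_infraredConstant (K : Fin 3 → ℝ) :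
    anisoLatticeGreen K = infraredConstant K := by
  unfold anisoLatticeGreen infraredConstant
  rw [div_eq_inv_mul]
  rfl

/-- **The layered threshold in Kennedy–Lieb–Shastry form**:
`anisoLatticeGreen (J∥,J∥,J⊥) = C(J⊥/J∥)/J∥` with `C = klsConstant` (`J∥ ≠ 0`).
[cite: KLS1988JSP, eq. (7)] [cite: FILS1978, §4, (4.7)] -/
theorem anisoLatticeGreen_layeredCoupling {Jpar Jperp : ℝ} (hpar : Jpar ≠ 0) :
    anisoLatticeGreen (layeredCoupling Jpar Jperp) = klsConstant (Jperp / Jpar) / Jpar := by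
  rw [anisoLatticeGreen_eq_infraredConstant, infraredConstant_layeredCoupling hpar]

/-- `anisoLatticeGreen (1,1,r) = klsConstant r`. [cite: KLS1988JSP, eq. (7)] -/
theorem anisoLatticeGreen_layeredCoupling_one (r : ℝ) :
    anisoLatticeGreen (layeredCoupling 1 r) = klsConstant r := by
  rw [anisoLatticeGreen_layeredCoupling one_ne_zero, div_one, div_one]

/-- The finite-volume object in the same currency:
`anisoTorusGreen L (J∥,J∥,J⊥) = (L⁻³∑_{k≠0} 1/E^r_{2πk/L}) / J∥`, `r = J⊥/J∥`, `E^r = klsDispersion r`.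
[cite: KLS1988JSP, eq. (7)] -/
theorem anisoTorusGreen_layeredCoupling {L : ℕ} [NeZero L] {Jpar Jperp : ℝ} (hpar : Jpar ≠ 0) :
    anisoTorusGreen L (layeredCoupling Jpar Jperp) =
      (1 / (L : ℝ) ^ 3 * ∑ k ∈ Finset.univ.erase (0 : TorusSite 3 L),
        1 / klsDispersion (Jperp / Jpar) (latticeMomentum L k)) / Jpar := by
  unfold anisoTorusGreen
  simp_rw [nVector_anisoDispersion_eq, anisoDispersion_layeredCoupling hpar, ← one_div_mul_one_div]
  rw [← Finset.mul_sum]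
  ring

/-- **The explicit logarithmic bound transported to `anisoLatticeGreen`** (the lineage-independent
reading of `klsConstant_le_sharp`): for `0 < r ≤ 1`,
`anisoLatticeGreen (1,1,r) ≤ 1 + π/4 + (π/8)·log(1/r)`. [cite: FILS1978, §4, (4.7)] [cite: KLS1988JSP, eq. (7)] -/
theorem anisoLatticeGreen_layeredCoupling_one_le {r : ℝ} (hr : 0 < r) (hr1 : r ≤ 1) :
    anisoLatticeGreen (layeredCoupling 1 r) ≤ 1 + π / 4 + π / 8 * Real.log (1 / r) := by
  rw [anisoLatticeGreen_layeredCoupling_one]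
  exact klsConstant_le_sharp hr hr1

end AnisotropicRotator

end Literature.Probability.LatticeModels
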